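import Summits.NavierStokesRegularity.NavierStokesRegularity.Theorems.EulerZoomLiouvillePowerGaugeEulerLiouvilleEnergySaturationShell

/-!
# Energy saturation on rung C1 of the crux `EulerZoomLiouville.PowerGaugeEulerLiouville`, IV:
# ball quantities through the TAIL SUPREMUM of the normalised energy
# (crux = stmt-NavierStokesRegularity-19832, route №10 `EulerZoomLiouville`, line `birth`)

Seat `ns-ezl-19832-w2` (stub-worker under the crux lead `ns-ezl-19832-p1`), cell ns-regularity-ideate.

Bookkeeping for the saturation bootstrap.  With the cut-off `σ` of `exists_radialCutoff` and the
normalised energy `N_σ(R) = R^{2ρ−1} ∫ σ(R⁻¹y)|V|²` (files I–III), suppose that on a range of scales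
the normalised energy is at most `S` — `∫ σ(R⁻¹y)|V|² ≤ R^{1−2ρ} S` — where `0 ≤ S ≤ 3c` (the `A`-gauge
makes `N_σ ≤ 3^{1−2ρ} c ≤ 3c` always, `normEnergy_le_three_mul`).  Then at every such scale `R ≥ 1`
(all bounds in the form `∫⁻ … ≤ ENNReal.ofReal (const · S^{1/2} · R^{power})`, constants depending on
`ρ, c, ‖Dσ‖_∞` only):

* `lintegral_ball_sq_le_cutoffEnergy` — `∫_{B_R}|V|² ≤ ∫σ(R⁻¹y)|V|²`;
* `lintegral_ball_cube_le_of_sup` — `∫_{B_R}|V|³ ≤ K₂ S^{1/2} R^{(6−9ρ)/4}` (file III's `N^{3/4}` bound,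
  one quarter power of `N` traded for `(3c)^{1/4}`);
* `lintegral_halfBall_norm_le_of_sup` — `∫_{B_{R/2}}|V| ≤ K₅ S^{1/2} R^{2−ρ}` (Cauchy–Schwarz);
* `lintegral_ball_pressure_one_le` — `∫_{B_R}|P| ≤ K₆ R^{(7−4ρ)/3}` (Hölder `(3, 3/2)` and the
  `D`-growth).

These feed the lead's local pressure splitting `exists_setLIntegral_pressure_velocity_ball_le` in the
sequel, where every pressure piece turns out at least as good as the cubic one: the shell flux is
`≲ S^{1/2} r^{(6−9ρ)/4}` with NO threshold in `ρ`.  WHAT THIS IS NOT: not NS regularity, not the crux,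
not rung C1 — estimates serving the energy-saturation stratum; `--supports` stmt-19832. [folklore]
-/

noncomputable section

set_option linter.dupNamespace false

open MeasureTheory Set Filter Topology Metric Function TopologicalSpace
open scoped ENNReal NNReal RealInnerProductSpace ContDiff

namespace Summit.NavierStokesRegularity.NavierStokesRegularity.Theorems.PowerGaugeEulerLiouville

open Literature.Analysis Literature.Analysis.FunctionSpaces Literature.Analysis.FluidPDE

namespace EnergySaturation

variable {ρ : ℝ} {σ : EuclideanSpace ℝ (Fin 3) → ℝ}
  {V : EuclideanSpace ℝ (Fin 3) → EuclideanSpace ℝ (Fin 3)} {P : EuclideanSpace ℝ (Fin 3) → ℝ}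
  {G : EuclideanSpace ℝ (Fin 3) → EuclideanSpace ℝ (Fin 3) →L[ℝ] EuclideanSpace ℝ (Fin 3)}

/-! ## The energy of a ball through the cut-off energy -/

/-- `∫_{B_R}|V|² ≤ ∫ σ(R⁻¹y)|V|²` for a cut-off with `0 ≤ σ`, `σ = 1` on `B̄₁` (`R > 0`,
`|V|² ∈ L¹_loc`). [folklore] -/
theorem lintegral_ball_sq_le_cutoffEnergy (hσc : Continuous σ) (hσs : HasCompactSupport σ)
    (h0 : ∀ z, 0 ≤ σ z) (hone : ∀ z, ‖z‖ ≤ 1 → σ z = 1)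
    (hV2 : LocallyIntegrable (fun y => ‖V y‖ ^ 2) volume) {R : ℝ} (hR : 0 < R) :
    ∫⁻ y in ball (0 : EuclideanSpace ℝ (Fin 3)) R, ‖V y‖ₑ ^ 2 ≤
      ENNReal.ofReal (∫ y, σ (R⁻¹ • y) * ‖V y‖ ^ 2) := by
  have hint : Integrable (fun y => σ (R⁻¹ • y) * ‖V y‖ ^ 2) volume := by
    have hcont : Continuous (fun y : EuclideanSpace ℝ (Fin 3) => σ (R⁻¹ • y)) :=
      hσc.comp (continuous_const_smul _)
    have := hV2.integrable_smul_left_of_hasCompactSupport hcont (hσs.comp_smul (inv_ne_zero hR.ne'))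
    simpa only [smul_eq_mul] using this
  rw [ofReal_integral_eq_lintegral_ofReal hint
    (Eventually.of_forall fun y => mul_nonneg (h0 _) (sq_nonneg _)), ← lintegral_indicator measurableSet_ball]
  refine lintegral_mono fun y => ?_
  by_cases hy : y ∈ ball (0 : EuclideanSpace ℝ (Fin 3)) R
  · rw [indicator_of_mem hy]
    rw [mem_ball, dist_zero_right] at hy
    have h1 : σ (R⁻¹ • y) = 1 := by
      apply hone
      rw [norm_smul, norm_inv, Real.norm_of_nonneg hR.le, inv_mul_le_iff₀ hR]
      linarith
    rw [h1, one_mul, ← ofReal_norm, ← ENNReal.ofReal_pow (norm_nonneg _)]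
  · rw [indicator_of_notMem hy]; exact zero_le

/-- **The normalised energy is bounded by the `A`-gauge**: `R^{2ρ−1} ∫ σ(R⁻¹y)|V|² ≤ 3^{1−2ρ} c` for
every `R > 0` (`σ ≤ 1` vanishes off `B_{2R} ⊂ B_{3R}`, and `∫_{B_{3R}}|V|² ≤ c(3R)^{1−2ρ}`). [folklore] -/
theorem normEnergy_le_of_growth
    (h0 : ∀ z, 0 ≤ σ z) (h1 : ∀ z, σ z ≤ 1) (hzero : ∀ z, 2 ≤ ‖z‖ → σ z = 0)
    (hVm : AEStronglyMeasurable V volume) {c : ℝ≥0}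
    (hA : ∀ L : ℝ, 0 < L → ∫⁻ y in ball (0 : EuclideanSpace ℝ (Fin 3)) L, ‖V y‖ₑ ^ 2 ≤
      (c : ℝ≥0∞) * ENNReal.ofReal (L ^ (1 - 2 * ρ))) {R : ℝ} (hR : 0 < R) :
    R ^ (2 * ρ - 1) * ∫ y, σ (R⁻¹ • y) * ‖V y‖ ^ 2 ≤ (3 : ℝ) ^ (1 - 2 * ρ) * c := by
  have hV2 : LocallyIntegrable (fun y => ‖V y‖ ^ 2) volume := locallyIntegrable_norm_sq_of_growth hVm hA
  set B : Set (EuclideanSpace ℝ (Fin 3)) := ball 0 (3 * R) with hB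
  have hV2B : IntegrableOn (fun y => ‖V y‖ ^ 2) B volume :=
    (memLp_two_iff_integrable_sq_norm hVm.restrict).1 (memLp_two_ball_of_growth hVm hA (by positivity))
  -- `∫ σ_R |V|² ≤ ∫_{B_{3R}} |V|²`
  have hle : ∫ y, σ (R⁻¹ • y) * ‖V y‖ ^ 2 ≤ ∫ y in B, ‖V y‖ ^ 2 := by
    rw [← integral_indicator measurableSet_ball]
    refine integral_mono_of_nonneg (Eventually.of_forall fun y => mul_nonneg (h0 _) (sq_nonneg _))
      (hV2B.integrable_indicator measurableSet_ball) (Eventually.of_forall fun y => ?_)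
    by_cases hy : y ∈ B
    · rw [indicator_of_mem hy]
      exact mul_le_of_le_one_left (sq_nonneg _) (h1 _)
    · rw [indicator_of_notMem hy]
      rw [hB, mem_ball, dist_zero_right, not_lt] at hy
      have : σ (R⁻¹ • y) = 0 := by
        apply hzero
        rw [norm_smul, norm_inv, Real.norm_of_nonneg hR.le, le_inv_mul_iff₀ hR]
        linarith
      show σ (R⁻¹ • y) * ‖V y‖ ^ 2 ≤ 0
      rw [this, zero_mul]
  -- `∫_{B_{3R}} |V|² ≤ c (3R)^{1-2ρ}`
  have hball : ∫ y in B, ‖V y‖ ^ 2 ≤ c * (3 * R) ^ (1 - 2 * ρ) := by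
    have h := hA (3 * R) (by positivity)
    rw [integral_eq_lintegral_of_nonneg_ae (Eventually.of_forall fun y => sq_nonneg _)
      hV2B.aestronglyMeasurable]
    have e : ∫⁻ y in B, ENNReal.ofReal (‖V y‖ ^ 2) = ∫⁻ y in B, ‖V y‖ₑ ^ 2 :=
      lintegral_congr fun y => by rw [← ofReal_norm, ENNReal.ofReal_pow (norm_nonneg _)]
    rw [e]
    have hfin : (c : ℝ≥0∞) * ENNReal.ofReal ((3 * R) ^ (1 - 2 * ρ)) ≠ ⊤ :=
      ENNReal.mul_ne_top ENNReal.coe_ne_top ENNReal.ofReal_ne_top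
    calc (∫⁻ y in B, ‖V y‖ₑ ^ 2).toReal ≤ ((c : ℝ≥0∞) * ENNReal.ofReal ((3 * R) ^ (1 - 2 * ρ))).toReal :=
          ENNReal.toReal_mono hfin h
      _ = c * (3 * R) ^ (1 - 2 * ρ) := by
          rw [ENNReal.toReal_mul, ENNReal.coe_toReal, ENNReal.toReal_ofReal (by positivity)]
  have h3 : (3 * R) ^ (1 - 2 * ρ) = (3 : ℝ) ^ (1 - 2 * ρ) * R ^ (1 - 2 * ρ) :=
    Real.mul_rpow (by norm_num) hR.le
  have hRR : R ^ (2 * ρ - 1) * R ^ (1 - 2 * ρ) = 1 := by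
    rw [← Real.rpow_add hR]; norm_num
  calc R ^ (2 * ρ - 1) * ∫ y, σ (R⁻¹ • y) * ‖V y‖ ^ 2
      ≤ R ^ (2 * ρ - 1) * (c * (3 * R) ^ (1 - 2 * ρ)) := by
        gcongr; exact hle.trans hball
    _ = (3 : ℝ) ^ (1 - 2 * ρ) * c * (R ^ (2 * ρ - 1) * R ^ (1 - 2 * ρ)) := by rw [h3]; ring
    _ = (3 : ℝ) ^ (1 - 2 * ρ) * c := by rw [hRR, mul_one]

/-! ## Ball quantities through the tail supremum `S` -/

/-- Power degradation of the tail supremum: `S^θ ≤ T^{θ−1/2} S^{1/2}` for `0 ≤ S ≤ T`, `1/2 ≤ θ`.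
[folklore] -/
theorem rpow_le_rpow_half {S T θ : ℝ} (hS : 0 ≤ S) (hST : S ≤ T) (hθ : 1 / 2 ≤ θ) :
    S ^ θ ≤ T ^ (θ - 1 / 2) * S ^ (1 / 2 : ℝ) := by
  rcases eq_or_lt_of_le hS with h | h
  · rw [← h]
    rcases eq_or_lt_of_le hθ with h' | h'
    · rw [← h']; simp
    · rw [Real.zero_rpow (by linarith), Real.zero_rpow (by norm_num), mul_zero]
  · have e : S ^ θ = S ^ (θ - 1 / 2) * S ^ (1 / 2 : ℝ) := by
      rw [← Real.rpow_add h]; ring_nf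
    rw [e]
    exact mul_le_mul_of_nonneg_right (Real.rpow_le_rpow hS hST (by linarith))
      (Real.rpow_nonneg hS _)

/-- **Cubic ball bound through the tail supremum**: if `∫σ(R⁻¹y)|V|² ≤ R^{1−2ρ} S` with
`0 ≤ S ≤ 3c` and `R ≥ 1`, then `∫_{B_R}|V|³ ≤ K₂ S^{1/2} R^{(6−9ρ)/4}` with
`K₂ = K^{3/2} C_G^{3/4} (3c)^{1/4}` (file III's bound `lintegral_ball_cube_le`). [folklore] -/
theorem lintegral_ball_cube_le_of_sup (hρ : 0 < ρ) (hρ1 : ρ < 1)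
    (hσ : IsTestFunctionOn (⊤ : Opens (EuclideanSpace ℝ (Fin 3))) σ) (h0 : ∀ z, 0 ≤ σ z)
    (h1 : ∀ z, σ z ≤ 1) (hone : ∀ z, ‖z‖ ≤ 1 → σ z = 1) (hzero : ∀ z, 2 ≤ ‖z‖ → σ z = 0)
    {M : ℝ} (hM : ∀ z, ‖fderiv ℝ σ z‖ ≤ M)
    (hVm : AEStronglyMeasurable V volume) (hGm : AEStronglyMeasurable G volume)
    (hVG : HasWeakFDerivOn (⊤ : Opens (EuclideanSpace ℝ (Fin 3))) volume V G) {c : ℝ≥0}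
    (hA : ∀ L : ℝ, 0 < L → ∫⁻ y in ball (0 : EuclideanSpace ℝ (Fin 3)) L, ‖V y‖ₑ ^ 2 ≤
      (c : ℝ≥0∞) * ENNReal.ofReal (L ^ (1 - 2 * ρ)))
    (hE : ∫⁻ y, ENNReal.ofReal (frobeniusNormSq (G y)) * ENNReal.ofReal (‖y‖ ^ (ρ - 1)) ≤
      ENNReal.ofReal ((1 - ρ) / (2 + ρ)) * (c : ℝ≥0∞))
    {S : ℝ} (hS : 0 ≤ S) (hS3 : S ≤ 3 * c) {R : ℝ} (hR : 1 ≤ R)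
    (hsup : ∫ y, σ (R⁻¹ • y) * ‖V y‖ ^ 2 ≤ R ^ (1 - 2 * ρ) * S) :
    ∫⁻ y in ball (0 : EuclideanSpace ℝ (Fin 3)) R, ‖V y‖ₑ ^ (3 : ℕ) ≤
      ENNReal.ofReal (((SNormLESNormFDerivOfEqConst (EuclideanSpace ℝ (Fin 3))
            (volume : Measure (EuclideanSpace ℝ (Fin 3))) 2 : ℝ) ^ (3 / 2 : ℝ) *
          (2 * (3 : ℝ) ^ (1 - ρ) * ((1 - ρ) / (2 + ρ) * c) +
            6 * M ^ 2 * (3 : ℝ) ^ (1 - 2 * ρ) * c) ^ (3 / 4 : ℝ) * (3 * c) ^ (1 / 4 : ℝ)) *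
        S ^ (1 / 2 : ℝ) * R ^ ((6 - 9 * ρ) / 4)) := by
  have hR0 : 0 < R := lt_of_lt_of_le one_pos hR
  set K : ℝ := (SNormLESNormFDerivOfEqConst (EuclideanSpace ℝ (Fin 3))
    (volume : Measure (EuclideanSpace ℝ (Fin 3))) 2 : ℝ) with hK
  have hK0 : 0 ≤ K := NNReal.coe_nonneg _
  set CG : ℝ := 2 * (3 : ℝ) ^ (1 - ρ) * ((1 - ρ) / (2 + ρ) * c) +
    6 * M ^ 2 * (3 : ℝ) ^ (1 - 2 * ρ) * c with hCG
  have h1ρ : 0 ≤ (1 - ρ) / (2 + ρ) := by apply div_nonneg <;> linarith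
  have hc0 : (0 : ℝ) ≤ c := c.2
  have hCG0 : 0 ≤ CG := by positivity
  have hI0 : 0 ≤ ∫ y, σ (R⁻¹ • y) * ‖V y‖ ^ 2 := integral_nonneg fun y => mul_nonneg (h0 _) (sq_nonneg _)
  have hcube := lintegral_ball_cube_le hρ hρ1 hσ h0 h1 hone hzero hM hVm hGm hVG hA hE hR
  refine hcube.trans ?_
  -- rewrite the `ℝ≥0∞` bound as `ofReal` of a real number
  set I : ℝ := ∫ y, σ (R⁻¹ • y) * ‖V y‖ ^ 2 with hI
  have eK : ((SNormLESNormFDerivOfEqConst (EuclideanSpace ℝ (Fin 3))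
      (volume : Measure (EuclideanSpace ℝ (Fin 3))) 2 : ℝ≥0∞)) ^ (3 / 2 : ℝ) = ENNReal.ofReal (K ^ (3 / 2 : ℝ)) := by
    rw [hK, ← ENNReal.ofReal_coe_nnreal, ENNReal.ofReal_rpow_of_nonneg (NNReal.coe_nonneg _) (by norm_num)]
  have eR : ENNReal.ofReal I ^ (3 / 4 : ℝ) * (ENNReal.ofReal (K ^ (3 / 2 : ℝ)) *
      ENNReal.ofReal (CG * R ^ (1 - ρ)) ^ (3 / 4 : ℝ)) =
      ENNReal.ofReal (I ^ (3 / 4 : ℝ) * (K ^ (3 / 2 : ℝ) * (CG * R ^ (1 - ρ)) ^ (3 / 4 : ℝ))) := by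
    rw [ENNReal.ofReal_rpow_of_nonneg hI0 (by norm_num),
      ENNReal.ofReal_rpow_of_nonneg (by positivity) (by norm_num),
      ← ENNReal.ofReal_mul (by positivity), ← ENNReal.ofReal_mul (by positivity)]
  rw [eK, eR]
  refine ENNReal.ofReal_le_ofReal ?_
  -- the real inequality
  have hI34 : I ^ (3 / 4 : ℝ) ≤ (R ^ (1 - 2 * ρ) * S) ^ (3 / 4 : ℝ) :=
    Real.rpow_le_rpow hI0 hsup (by norm_num)
  have hS34 : S ^ (3 / 4 : ℝ) ≤ (3 * c) ^ (1 / 4 : ℝ) * S ^ (1 / 2 : ℝ) := by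
    have := rpow_le_rpow_half hS hS3 (by norm_num : (1:ℝ) / 2 ≤ 3 / 4)
    norm_num at this ⊢
    exact this
  have e1 : (R ^ (1 - 2 * ρ) * S) ^ (3 / 4 : ℝ) = R ^ ((1 - 2 * ρ) * (3 / 4)) * S ^ (3 / 4 : ℝ) := by
    rw [Real.mul_rpow (Real.rpow_nonneg hR0.le _) hS, ← Real.rpow_mul hR0.le]
  have e2 : (CG * R ^ (1 - ρ)) ^ (3 / 4 : ℝ) = CG ^ (3 / 4 : ℝ) * R ^ ((1 - ρ) * (3 / 4)) := by
    rw [Real.mul_rpow hCG0 (Real.rpow_nonneg hR0.le _), ← Real.rpow_mul hR0.le]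
  have e3 : R ^ ((1 - 2 * ρ) * (3 / 4)) * R ^ ((1 - ρ) * (3 / 4)) = R ^ ((6 - 9 * ρ) / 4) := by
    rw [← Real.rpow_add hR0]; ring_nf
  calc I ^ (3 / 4 : ℝ) * (K ^ (3 / 2 : ℝ) * (CG * R ^ (1 - ρ)) ^ (3 / 4 : ℝ))
      ≤ (R ^ (1 - 2 * ρ) * S) ^ (3 / 4 : ℝ) * (K ^ (3 / 2 : ℝ) * (CG * R ^ (1 - ρ)) ^ (3 / 4 : ℝ)) := by
        gcongr
    _ = K ^ (3 / 2 : ℝ) * CG ^ (3 / 4 : ℝ) * S ^ (3 / 4 : ℝ) *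
          (R ^ ((1 - 2 * ρ) * (3 / 4)) * R ^ ((1 - ρ) * (3 / 4))) := by rw [e1, e2]; ring
    _ ≤ K ^ (3 / 2 : ℝ) * CG ^ (3 / 4 : ℝ) * ((3 * c) ^ (1 / 4 : ℝ) * S ^ (1 / 2 : ℝ)) *
          (R ^ ((1 - 2 * ρ) * (3 / 4)) * R ^ ((1 - ρ) * (3 / 4))) := by
        gcongr
    _ = K ^ (3 / 2 : ℝ) * CG ^ (3 / 4 : ℝ) * (3 * c) ^ (1 / 4 : ℝ) * S ^ (1 / 2 : ℝ) *
          R ^ ((6 - 9 * ρ) / 4) := by rw [e3]; ring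

/-- Volume of a ball of `ℝ³` as `ofReal`. [folklore] -/
theorem volume_ball_eq_ofReal {r : ℝ} (hr : 0 < r) :
    (volume : Measure (EuclideanSpace ℝ (Fin 3))) (ball 0 r) =
      ENNReal.ofReal (r ^ 3 * (volume (ball (0 : EuclideanSpace ℝ (Fin 3)) 1)).toReal) := by
  rw [Measure.addHaar_ball_of_pos volume (0 : EuclideanSpace ℝ (Fin 3)) hr, finrank_euclideanSpace_fin,
    ENNReal.ofReal_mul (by positivity), ENNReal.ofReal_toReal measure_ball_lt_top.ne]

/-- **`L¹` mass of `V` on the half ball through the tail supremum** (Cauchy–Schwarz):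
`∫_{B_{R/2}}|V| ≤ (v₁/8)^{1/2} S^{1/2} R^{2−ρ}` when `∫σ(R⁻¹y)|V|² ≤ R^{1−2ρ}S`, `v₁ = |B₁|`.
[folklore] -/
theorem lintegral_halfBall_norm_le_of_sup (hσc : Continuous σ) (hσs : HasCompactSupport σ)
    (h0 : ∀ z, 0 ≤ σ z) (hone : ∀ z, ‖z‖ ≤ 1 → σ z = 1)
    (hVm : AEStronglyMeasurable V volume)
    (hV2 : LocallyIntegrable (fun y => ‖V y‖ ^ 2) volume)
    {S : ℝ} (hS : 0 ≤ S) {R : ℝ} (hR : 0 < R)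
    (hsup : ∫ y, σ (R⁻¹ • y) * ‖V y‖ ^ 2 ≤ R ^ (1 - 2 * ρ) * S) :
    ∫⁻ y in ball (0 : EuclideanSpace ℝ (Fin 3)) (R / 2), ‖V y‖ₑ ≤
      ENNReal.ofReal (((volume (ball (0 : EuclideanSpace ℝ (Fin 3)) 1)).toReal / 8) ^ (1 / 2 : ℝ) *
        S ^ (1 / 2 : ℝ) * R ^ (2 - ρ)) := by
  set v₁ : ℝ := (volume (ball (0 : EuclideanSpace ℝ (Fin 3)) 1)).toReal with hv₁
  have hv₁0 : 0 ≤ v₁ := ENNReal.toReal_nonneg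
  set μ : Measure (EuclideanSpace ℝ (Fin 3)) := volume.restrict (ball (0 : EuclideanSpace ℝ (Fin 3)) (R / 2))
    with hμ
  -- Cauchy–Schwarz `∫ 1 · |V| ≤ (∫ 1)^{1/2} (∫ |V|²)^{1/2}`
  have hpq : (2 : ℝ).HolderConjugate 2 := by rw [Real.holderConjugate_iff]; norm_num
  have hCS := ENNReal.lintegral_mul_le_Lp_mul_Lq μ hpq (f := fun _ => (1 : ℝ≥0∞)) (g := fun y => ‖V y‖ₑ)
    aemeasurable_const hVm.restrict.enorm
  simp only [Pi.mul_apply, one_mul, lintegral_const, hμ,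
    Measure.restrict_apply_univ, ENNReal.rpow_ofNat, one_pow] at hCS
  -- the two factors
  have hvol : volume (ball (0 : EuclideanSpace ℝ (Fin 3)) (R / 2)) = ENNReal.ofReal ((R / 2) ^ 3 * v₁) :=
    volume_ball_eq_ofReal (by positivity)
  have hsq : ∫⁻ y in ball (0 : EuclideanSpace ℝ (Fin 3)) (R / 2), ‖V y‖ₑ ^ 2 ≤ ENNReal.ofReal (R ^ (1 - 2 * ρ) * S) := by
    refine (lintegral_mono_set (ball_subset_ball (by linarith))).trans
      ((lintegral_ball_sq_le_cutoffEnergy hσc hσs h0 hone hV2 hR).trans (ENNReal.ofReal_le_ofReal hsup))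
  calc ∫⁻ y in ball (0 : EuclideanSpace ℝ (Fin 3)) (R / 2), ‖V y‖ₑ
      ≤ (volume (ball (0 : EuclideanSpace ℝ (Fin 3)) (R / 2))) ^ (1 / (2 : ℝ)) *
          (∫⁻ y in ball (0 : EuclideanSpace ℝ (Fin 3)) (R / 2), ‖V y‖ₑ ^ 2) ^ (1 / (2 : ℝ)) := hCS
    _ ≤ (ENNReal.ofReal ((R / 2) ^ 3 * v₁)) ^ (1 / (2 : ℝ)) *
          (ENNReal.ofReal (R ^ (1 - 2 * ρ) * S)) ^ (1 / (2 : ℝ)) := by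
        rw [hvol]; gcongr
    _ = ENNReal.ofReal (((R / 2) ^ 3 * v₁) ^ (1 / 2 : ℝ) * (R ^ (1 - 2 * ρ) * S) ^ (1 / 2 : ℝ)) := by
        rw [ENNReal.ofReal_rpow_of_nonneg (by positivity) (by norm_num),
          ENNReal.ofReal_rpow_of_nonneg (by positivity) (by norm_num), ← ENNReal.ofReal_mul (by positivity)]
    _ = ENNReal.ofReal ((v₁ / 8) ^ (1 / 2 : ℝ) * S ^ (1 / 2 : ℝ) * R ^ (2 - ρ)) := by
        congr 1
        have eR3 : (R / 2) ^ 3 * v₁ = R ^ (3 : ℝ) * (v₁ / 8) := by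
          rw [show R ^ (3 : ℝ) = R ^ (3 : ℕ) by norm_cast]; ring
        rw [eR3, Real.mul_rpow (by positivity) (by positivity), Real.mul_rpow (by positivity) hS,
          ← Real.rpow_mul hR.le, ← Real.rpow_mul hR.le]
        have e4 : R ^ ((3 : ℝ) * (1 / 2)) * R ^ ((1 - 2 * ρ) * (1 / 2)) = R ^ (2 - ρ) := by
          rw [← Real.rpow_add hR]; ring_nf
        calc R ^ ((3 : ℝ) * (1 / 2)) * (v₁ / 8) ^ (1 / 2 : ℝ) * (R ^ ((1 - 2 * ρ) * (1 / 2)) * S ^ (1 / 2 : ℝ))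
            = (v₁ / 8) ^ (1 / 2 : ℝ) * S ^ (1 / 2 : ℝ) * (R ^ ((3 : ℝ) * (1 / 2)) * R ^ ((1 - 2 * ρ) * (1 / 2))) := by
              ring
          _ = (v₁ / 8) ^ (1 / 2 : ℝ) * S ^ (1 / 2 : ℝ) * R ^ (2 - ρ) := by rw [e4]

/-- **`L¹` mass of the pressure on a ball** (Hölder `(3, 3/2)` and the `D`-growth):
`∫_{B_R}|P| ≤ v₁^{1/3} c_D^{2/3} R^{(7−4ρ)/3}`, `c_D = ((2−2ρ)/(2+ρ))c`. [folklore] -/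
theorem lintegral_ball_pressure_one_le (hρ : 0 < ρ) (hρ1 : ρ < 1) (hPm : AEStronglyMeasurable P volume)
    {c : ℝ≥0}
    (hD : ∫⁻ y, ‖P y‖ₑ ^ (3 / 2 : ℝ) * ENNReal.ofReal (‖y‖ ^ (2 * ρ - 2)) ≤
      ENNReal.ofReal ((2 - 2 * ρ) / (2 + ρ)) * (c : ℝ≥0∞)) {R : ℝ} (hR : 0 < R) :
    ∫⁻ y in ball (0 : EuclideanSpace ℝ (Fin 3)) R, ‖P y‖ₑ ≤
      ENNReal.ofReal ((volume (ball (0 : EuclideanSpace ℝ (Fin 3)) 1)).toReal ^ (1 / 3 : ℝ) *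
        ((2 - 2 * ρ) / (2 + ρ) * c) ^ (2 / 3 : ℝ) * R ^ ((7 - 4 * ρ) / 3)) := by
  set v₁ : ℝ := (volume (ball (0 : EuclideanSpace ℝ (Fin 3)) 1)).toReal with hv₁
  have hv₁0 : 0 ≤ v₁ := ENNReal.toReal_nonneg
  have hcD : 0 ≤ (2 - 2 * ρ) / (2 + ρ) * c := by
    have : 0 ≤ (2 - 2 * ρ) / (2 + ρ) := by apply div_nonneg <;> linarith
    exact mul_nonneg this c.2
  set μ : Measure (EuclideanSpace ℝ (Fin 3)) := volume.restrict (ball (0 : EuclideanSpace ℝ (Fin 3)) R) with hμ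
  have hpq : (3 : ℝ).HolderConjugate (3 / 2) := by rw [Real.holderConjugate_iff]; norm_num
  have hH := ENNReal.lintegral_mul_le_Lp_mul_Lq μ hpq (f := fun _ => (1 : ℝ≥0∞)) (g := fun y => ‖P y‖ₑ)
    aemeasurable_const hPm.restrict.enorm
  simp only [Pi.mul_apply, one_mul, ENNReal.one_rpow, lintegral_const, hμ,
    Measure.restrict_apply_univ] at hH
  have hvol : volume (ball (0 : EuclideanSpace ℝ (Fin 3)) R) = ENNReal.ofReal (R ^ 3 * v₁) :=
    volume_ball_eq_ofReal hR
  have hD' : ∫⁻ y in ball (0 : EuclideanSpace ℝ (Fin 3)) R, ‖P y‖ₑ ^ (3 / 2 : ℝ) ≤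
      ENNReal.ofReal (R ^ (2 - 2 * ρ) * ((2 - 2 * ρ) / (2 + ρ) * c)) := by
    refine (lintegral_ball_pressure_le_of_weight hρ1 hD hR).trans (le_of_eq ?_)
    have h22 : 0 ≤ (2 - 2 * ρ) / (2 + ρ) := by apply div_nonneg <;> linarith
    rw [ENNReal.ofReal_mul (by positivity), ENNReal.ofReal_mul h22, ENNReal.ofReal_coe_nnreal]
  calc ∫⁻ y in ball (0 : EuclideanSpace ℝ (Fin 3)) R, ‖P y‖ₑ
      ≤ (volume (ball (0 : EuclideanSpace ℝ (Fin 3)) R)) ^ (1 / (3 : ℝ)) *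
          (∫⁻ y in ball (0 : EuclideanSpace ℝ (Fin 3)) R, ‖P y‖ₑ ^ (3 / 2 : ℝ)) ^ (1 / (3 / 2 : ℝ)) := hH
    _ ≤ (ENNReal.ofReal (R ^ 3 * v₁)) ^ (1 / (3 : ℝ)) *
          (ENNReal.ofReal (R ^ (2 - 2 * ρ) * ((2 - 2 * ρ) / (2 + ρ) * c))) ^ (1 / (3 / 2 : ℝ)) := by
        rw [hvol]; gcongr
    _ = ENNReal.ofReal ((R ^ 3 * v₁) ^ (1 / 3 : ℝ) * (R ^ (2 - 2 * ρ) * ((2 - 2 * ρ) / (2 + ρ) * c)) ^ (2 / 3 : ℝ)) := by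
        rw [show (1 / (3 / 2 : ℝ)) = 2 / 3 by norm_num,
          ENNReal.ofReal_rpow_of_nonneg (by positivity) (by norm_num),
          ENNReal.ofReal_rpow_of_nonneg (by positivity) (by norm_num), ← ENNReal.ofReal_mul (by positivity)]
    _ = ENNReal.ofReal (v₁ ^ (1 / 3 : ℝ) * ((2 - 2 * ρ) / (2 + ρ) * c) ^ (2 / 3 : ℝ) * R ^ ((7 - 4 * ρ) / 3)) := by
        congr 1
        rw [show R ^ 3 = R ^ (3 : ℝ) by norm_cast, Real.mul_rpow (by positivity) hv₁0,
          Real.mul_rpow (by positivity) hcD, ← Real.rpow_mul hR.le, ← Real.rpow_mul hR.le]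
        have e4 : R ^ ((3 : ℝ) * (1 / 3)) * R ^ ((2 - 2 * ρ) * (2 / 3)) = R ^ ((7 - 4 * ρ) / 3) := by
          rw [← Real.rpow_add hR]; ring_nf
        calc R ^ ((3 : ℝ) * (1 / 3)) * v₁ ^ (1 / 3 : ℝ) * (R ^ ((2 - 2 * ρ) * (2 / 3)) * ((2 - 2 * ρ) / (2 + ρ) * c) ^ (2 / 3 : ℝ))
            = v₁ ^ (1 / 3 : ℝ) * ((2 - 2 * ρ) / (2 + ρ) * c) ^ (2 / 3 : ℝ) *
                (R ^ ((3 : ℝ) * (1 / 3)) * R ^ ((2 - 2 * ρ) * (2 / 3))) := by ring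
          _ = _ := by rw [e4]

end EnergySaturation

end Summit.NavierStokesRegularity.NavierStokesRegularity.Theorems.PowerGaugeEulerLiouville

end
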